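import Summits.CriticalPhenomena.PercolationContinuityZ3.Theorems.Transplant.FKThreeApexOmegaClosure2
import Summits.CriticalPhenomena.PercolationContinuityZ3.Theorems.Transplant.FKThreeApexT5
import HarnessLib

/-!
# The three-apex monoid: `(U_a)` on the whole monoid and T5 unconditionally

Helper file (`--supports stmt-CriticalPhenomena-4575`), FK sub-lane `prim-bschramm-fk-3` (gen 14); builds on p205010 (kernel theorem, internal audit
signed; external expert review pending).  No sorries; standard axioms.  Memo `bschramm/prim-bschramm-fk-3/DISJOINT-VIA-U.md`.

From the semigroup theorem `InOmega.conv` (layer 3b) and `IsLetter.inOmega` (layer 1): every element of the three-apex monoid `InK q` with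
`Z_0 > 0` lies in `Ω_q`; hence the upper-envelope condition `(U_a)`: `Φ_a(w₁,w₂)(Z) ≥ 0` for all `w₁,w₂ ≥ 0` and ALL `Z ∈ InK q` (`InK.uCond`, the
degenerate `Z_0 = 0` case being immediate), and therefore **T5 holds on the whole monoid** (`InK.rayleigh_T5_nonneg`): for `0 ≤ q ≤ 1`, leaf
probabilities `b, c ∈ [0,1]`, and every `R ∈ InK q`, the pinned Rayleigh difference of the leaf edge `ua` against the opposite triangle edge `bc` is
`≥ 0` — the disjoint pair `(leaf edge, opposite triangle edge)` of the weighted `K_{1,1,1,n}` is negatively correlated. [folklore]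
-/

noncomputable section

namespace Summit.CriticalPhenomena.PercolationContinuityZ3.Theorems

namespace FK

namespace ThreeApex

/-- The empty word `δ_0` lies in `Ω_q`. [folklore] -/
theorem delta0_inOmega (q : ℝ) : InOmega q delta0 := by
  refine ⟨by simp [delta0], by simp [hz, delta0], by simp [hx, delta0], by simp [hy, delta0], by simp [hx, hz, delta0, V5.total],
    by simp [hy, hz, delta0, V5.total], by simp [masterN, swapBC, delta0], by simp [masterN, delta0], fun w₁ w₂ _ _ => ?_⟩
  simp [uForm, masterN, massA, swapBC, delta0]

/-- Every element of the three-apex monoid with `Z_0 > 0` lies in `Ω_q` (`0 < q ≤ 1`). [folklore] -/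
theorem InK.inOmega {q : ℝ} (hq0 : 0 < q) (hq1 : q ≤ 1) {Z : V5} (h : InK q Z) (hu : 0 < Z.z0) : InOmega q Z := by
  induction h with
  | base => exact delta0_inOmega q
  | step hz hZ ih =>
    rename_i z Z'
    have hzz : (ThreeApex.conv z Z').z0 = z.z0 * Z'.z0 := rfl
    rw [hzz] at hu
    have hz0 : 0 ≤ z.z0 := (hz.nonneg hq0.le).h0
    have hZ0 : 0 ≤ Z'.z0 := (hZ.nonneg hq0.le).h0
    have hz0' : 0 < z.z0 := by
      rcases hz0.eq_or_lt with h0 | h0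
      · rw [← h0, zero_mul] at hu; exact absurd hu (lt_irrefl 0)
      · exact h0
    have hZ0' : 0 < Z'.z0 := by
      rcases hZ0.eq_or_lt with h0 | h0
      · rw [← h0, mul_zero] at hu; exact absurd hu (lt_irrefl 0)
      · exact h0
    exact (hz.inOmega hq0.le hq1 hz0').conv hq0 hq1 (ih hZ0')

/-- **`(U_a)` on the three-apex monoid**: `Φ_a(w₁,w₂)(Z) ≥ 0` for all `w₁, w₂ ≥ 0`, every `Z ∈ InK q`, `0 < q ≤ 1`. [folklore] -/
theorem InK.uCond {q : ℝ} (hq0 : 0 < q) (hq1 : q ≤ 1) {Z : V5} (h : InK q Z) :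
    ∀ w₁ w₂ : ℝ, 0 ≤ w₁ → 0 ≤ w₂ → 0 ≤ uForm q w₁ w₂ Z := by
  by_cases hu : 0 < Z.z0
  · exact (h.inOmega hq0 hq1 hu).U
  · have hnn := h.nonneg hq0.le
    have h0 : Z.z0 = 0 := le_antisymm (not_lt.1 hu) hnn.h0
    intro w₁ w₂ hw₁ hw₂
    have hNab : 0 ≤ masterN q (ThreeApex.swapBC Z) := h.swapBC.masterN_nonneg hq0.le hq1
    have hNac : 0 ≤ masterN q Z := h.masterN_nonneg hq0.le hq1
    have hJ : 0 ≤ jA Z := by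
      simp only [jA, hx, hy, hz, h0, V5.total]
      have := hnn.hab; have := hnn.hac; have := hnn.hbc
      nlinarith [mul_nonneg hnn.hbc hnn.hab, mul_nonneg hnn.hbc hnn.hac]
    have hp : 0 ≤ 2 - q := by linarith
    rw [uForm_eq]
    positivity

/-- **T5 on the three-apex monoid, unconditionally** (`0 ≤ q ≤ 1`, `b, c ∈ [0,1]`, `R ∈ InK q`): the pinned Rayleigh difference of the leaf
edge `ua` (leaf with remaining probabilities `b, c`) against the opposite triangle edge `bc` is `≥ 0`. [folklore] -/
theorem InK.rayleigh_T5_nonneg {q b c : ℝ} (hq0 : 0 ≤ q) (hq1 : q ≤ 1) (hb0 : 0 ≤ b) (hb1 : b ≤ 1) (hc0 : 0 ≤ c) (hc1 : c ≤ 1)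
    {R : V5} (hR : InK q R) :
    0 ≤ val q (conv (leaf q 1 b c) (conv (edgeBC 0) R)) * val q (conv (leaf q 0 b c) (conv (edgeBC 1) R)) -
        val q (conv (leaf q 1 b c) (conv (edgeBC 1) R)) * val q (conv (leaf q 0 b c) (conv (edgeBC 0) R)) := by
  rcases hq0.eq_or_lt with h | h
  · rw [rayleigh_T5_eq, ← h]; simp [t5Form]
  · exact rayleigh_T5_nonneg_of_UCond hq0 hq1 hb0 hb1 hc0 hc1 hR (hR.uCond h hq1)

end ThreeApex

end FK

end Summit.CriticalPhenomena.PercolationContinuityZ3.Theorems
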